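import Literature.Barriers.CriticalPhenomena.KozmaNachmiasLemma52
import Literature.Barriers.CriticalPhenomena.KozmaNachmiasTails
import Literature.Probability.Percolation.ClusterDeletionBound
import Literature.Probability.Percolation.HalfSpacePinnedPairs
import HarnessLib

/-!
# Kozma–Nachmias 2011, Lemma 5.3: `Σ_y P(E₁ ∩ E₂) ≥ c L² P(E₁)` PROVED

Barrier catalogue `Literature/Barriers/CriticalPhenomena/` (D-0021), programme for the named fact
`KozmaNachmias2011_thm2` via `KozmaNachmias2011_lemma51` (`KozmaNachmiasTheorem2.lean`). Chapter 5
of Kozma–Nachmias 2011 (p. 399) introduces, for `x ∈ ∂Q_j`, `y ∈ x + Q_L` and an auxiliary vertex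
`x'` near `x` outside `Q_j`, the events

`E₂(x, x', y) = {x' ↔ y off C(x; Q_j)}`, `E₃(x, x') = {C(x) ∩ C(x') = ∅}`,

and proves

> **Lemma 5.3.** There exists a constant `c > 0` such that if `K > 0` is large enough then for any
> `x ∈ ∂Q_j` and any `x' ∈ (x + Q_K) ∖ Q_{j+K/2}` we have `Σ_{y ∈ x + Q_L} P(E₁ ∩ E₂) ≥ c L² P(E₁)`.

This file vendors `E₂`, `E₃` with real bodies (`eventE2`, `eventE3`) and PROVES Lemma 5.3, following
the printed proof (pp. 400–401): conditioning on `C(x; Q_j) = A` ((5.3), `KozmaNachmiasE1.lean`),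
independence of `{x' ↔ y off A}` from the conditioned pairs ((5.4)), the splitting
`P(x' ↔ y off A) ≥ P(x' ↔ y) - Σ_{z ∈ A} P(x' ↔ z) P(z ↔ y)` ((5.5), BK), the dyadic decomposition
of `Σ_{z ∈ A} |z - x'|^{2-d}` ((5.6)) with the "simple bad configuration" bound (5.7) and the tail
`Σ_{2^t ≥ K} t⁷ 2^{t(6-d)} → 0` (`KozmaNachmiasTails.tail_large`), and the two-point sums of
`KozmaNachmiasTwoPointSums.lean`.

Conventions (ours, immaterial for the use in Lemma 5.1): the auxiliary vertex is any `x'` with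
`‖x' - x‖ ≤ 2K` and at sup-distance `≥ K` from `Q_j` (the source takes `x' ∈ (x + Q_K) ∖ Q_{j+K/2}`;
only "`|z - x'| ≥ cK` for `z ∈ Q_j`" and "`|x' - x| ≤ CK`" are used); the sum over `y` runs over
`y = x + w`, `w ∈ Q_L`, **with `y ∉ Q_j`** (the corrected admissibility of `KozmaNachmiasAdmissible.lean`;
the lower bound `Σ_y |x' - y|^{2-d} ≥ c L²` over these `y` is `sum_tau_lower`), for `L ≥ 2K`.

* `eventE2`, `eventE3`; `eventE2_inter_clusterInIs` (on `{C(x;Q_j) = A}`, `E₂` is `{x' ↔ y in Aᶜ}`);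
* `real_eventE1_inter_clusterInIs_inter_eventE2` — (5.3)–(5.4):
  `P(E₁ ∩ {C = A} ∩ E₂) = P(E₁ ∩ {C = A}) · P(x' ↔ y in Aᶜ)`;
* `tau_sub_sum_le_real_openConnIn_compl` — (5.5): `P(x' ↔ y in Aᶜ) ≥ τ(x',y) - Σ_{z ∈ A} τ(x',z) τ(z,y)`;
* `sum_twoPtWt_le_of_sparse` — (5.6)–(5.7) with the tail: `Σ_{z ∈ A} |z - x'|^{2-d} ≤ δ` for `K`
  large, whenever `A ⊆ Q_j` has fewer than `s⁴ log⁷ s` points in every `x + Q_s`, `s ≥ K`;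
* **`KozmaNachmias2011_lemma53`** — Lemma 5.3 at `p = p_c` under `TwoPointBoundedRatio d`, `d > 6`.

## References

* G. Kozma, A. Nachmias, *Arm exponents in high dimensional percolation*, J. Amer. Math. Soc. 24
  (2011) 375–409: Chapter 5, `E₁, E₂, E₃` (p. 399), Lemma 5.3 and its proof ((5.3)–(5.7),
  pp. 400–401).
* G. Grimmett, *Percolation*, 2nd ed., Springer 1999, §2.3 (BK inequality).
-/

noncomputable section

namespace Literature.Barriers.CriticalPhenomena

open _root_.MeasureTheory Finset Literature.Probability.LatticeModels Literature.Probability.Percolation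
  Literature.Probability.Percolation.DCT16
open scoped Literature.Probability.LatticeModels Literature.Probability.Percolation

variable {d : ℕ}

/-! ### The events `E₂` and `E₃` -/

section Events

/-- **`E₂(x, x', y) = {x' ↔ y off C(x; Q_j)}`** (Kozma–Nachmias 2011, p. 399): `x'` is joined to `y`
by an open path none of whose vertices lies in the cluster `C(x; Q_j)` of `x` inside `Q_j`.
[cite: KozmaNachmias2011, §5 (definition of E₂, p. 399)] -/
def eventE2 (j : ℕ) (x x' y : Site d) : Set (BondConfig (Site d)) :=
  {ω | ω ∈ openConnIn ((↑(clusterIn (box d j) x ω) : Set (Site d))ᶜ) x' y}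

/-- **`E₃(x, x') = {C(x) ∩ C(x') = ∅}`** (Kozma–Nachmias 2011, p. 399): `x` and `x'` are not joined
by an open path. [cite: KozmaNachmias2011, §5 (definition of E₃, p. 399)] -/
def eventE3 (x x' : Site d) : Set (BondConfig (Site d)) := (openConn x x' : Set (BondConfig (Site d)))ᶜ

/-- Unfolding lemma. [cite: KozmaNachmias2011, §5 (definition of E₂, p. 399)] -/
theorem mem_eventE2 {j : ℕ} {x x' y : Site d} {ω : BondConfig (Site d)} :
    ω ∈ eventE2 j x x' y ↔ ω ∈ openConnIn ((↑(clusterIn (box d j) x ω) : Set (Site d))ᶜ) x' y :=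
  Iff.rfl

/-- Unfolding lemma. [cite: KozmaNachmias2011, §5 (definition of E₃, p. 399)] -/
theorem mem_eventE3 {x x' : Site d} {ω : BondConfig (Site d)} :
    ω ∈ eventE3 x x' ↔ ¬(openGraph ω).Reachable x x' := Iff.rfl

/-- **On `{C(x; Q_j) = A}`, `E₂` is the event `{x' ↔ y in Aᶜ}`** (Kozma–Nachmias 2011, (5.3): "we
condition on `C(x; Q_j) = A` and get … `P(x' ↔ y off A | C(x;Q_j) = A)`").
[cite: KozmaNachmias2011, proof of Lemma 5.3 ((5.3), p. 400)] -/
theorem eventE2_inter_clusterInIs (j : ℕ) (x x' y : Site d) (A : Finset (Site d)) :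
    eventE2 j x x' y ∩ clusterInIs (box d j) x A =
      openConnIn ((↑A : Set (Site d))ᶜ) x' y ∩ clusterInIs (box d j) x A := by
  ext ω
  simp only [Set.mem_inter_iff, mem_eventE2, mem_clusterInIs]
  constructor
  · rintro ⟨h, hA⟩; exact ⟨hA ▸ h, hA⟩
  · rintro ⟨h, hA⟩; exact ⟨hA.symm ▸ h, hA⟩

/-- The pairs inside `Aᶜ` avoid the conditioned pairs of `A`. [cite: KozmaNachmias2011, proof of Lemma 5.3 ((5.4), p. 400: "the event {x' ↔ y off A} depends only on the status of edges not touching A")] -/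
theorem disjoint_clusterPairs_compl_sym2 (S A : Finset (Site d)) :
    Disjoint (↑(clusterPairs S A) : Set (Sym2 (Site d))) ((↑A : Set (Site d))ᶜ).sym2 := by
  rw [Set.disjoint_left]
  intro e he he'
  induction e using Sym2.ind with
  | h a b =>
    rw [Set.mk_mem_sym2_iff] at he'
    have : s(a, b) ∉ clusterPairs S A := by
      refine notMem_clusterPairs_of_forall fun w hw => ?_
      rcases Sym2.mem_iff.1 hw with rfl | rfl
      · exact fun h => he'.1 (Finset.mem_coe.2 h)
      · exact fun h => he'.2 (Finset.mem_coe.2 h)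
    exact this (Finset.mem_coe.1 he)

/-- `{x' ↔ y in Aᶜ}` is measurable. [cite: KozmaNachmias2011, proof of Lemma 5.3 ((5.3), p. 400)] -/
theorem measurableSet_openConnIn_compl (A : Finset (Site d)) (x' y : Site d) :
    MeasurableSet (openConnIn ((↑A : Set (Site d))ᶜ) x' y : Set (BondConfig (Site d))) :=
  measurableSet_openConnIn_of_countable _ x' y

/-- **(5.3)–(5.4)**: `P(E₁ ∩ {C(x;Q_j) = A} ∩ E₂) = P(E₁ ∩ {C(x;Q_j) = A}) · P(x' ↔ y in Aᶜ)`.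
[cite: KozmaNachmias2011, proof of Lemma 5.3 ((5.3)–(5.4), p. 400)] -/
theorem real_eventE1_inter_clusterInIs_inter_eventE2 (p : unitInterval) (j K M : ℕ) (x x' y : Site d)
    (A : Finset (Site d)) :
    (bondPercolation (zdGraph d) p).real (eventE1 p j K M x ∩ clusterInIs (box d j) x A ∩ eventE2 j x x' y) =
      (bondPercolation (zdGraph d) p).real (eventE1 p j K M x ∩ clusterInIs (box d j) x A) *
        (bondPercolation (zdGraph d) p).real (openConnIn ((↑A : Set (Site d))ᶜ) x' y) := by
  have hset : eventE1 p j K M x ∩ clusterInIs (box d j) x A ∩ eventE2 j x x' y =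
      eventE1 p j K M x ∩ clusterInIs (box d j) x A ∩ openConnIn ((↑A : Set (Site d))ᶜ) x' y := by
    ext ω
    simp only [Set.mem_inter_iff, mem_eventE2, mem_clusterInIs]
    constructor
    · rintro ⟨⟨h1, hA⟩, h⟩; exact ⟨⟨h1, hA⟩, hA ▸ h⟩
    · rintro ⟨⟨h1, hA⟩, h⟩; exact ⟨⟨h1, hA⟩, hA.symm ▸ h⟩
  rw [hset]
  exact real_inter_clusterInIs_inter_eq p clusterAtom_subset_eventE1 A
    (determinedBy_openConnIn ((↑A : Set (Site d))ᶜ) x' y (K := ((↑A : Set (Site d))ᶜ).sym2) le_rfl)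
    (measurableSet_openConnIn_compl A x' y) (disjoint_clusterPairs_compl_sym2 (box d j) A)

/-- **(5.5)**: `P(x' ↔ y in Aᶜ) ≥ τ(x', y) - Σ_{z ∈ A} τ(x', z) τ(z, y)` — an open path from `x'` to `y`
not inside `Aᶜ` passes through some `z ∈ A`, giving `{x' ↔ z} ∘ {z ↔ y}`, and BK.
[cite: KozmaNachmias2011, proof of Lemma 5.3 ((5.5), p. 400)] -/
theorem tau_sub_sum_le_real_openConnIn_compl (p : unitInterval) (A : Finset (Site d)) (x' y : Site d) :
    tau d p x' y - ∑ z ∈ A, tau d p x' z * tau d p z y ≤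
      (bondPercolation (zdGraph d) p).real (openConnIn ((↑A : Set (Site d))ᶜ) x' y) := by
  classical
  set μ := bondPercolation (zdGraph d) p with hμ
  have h1 : μ.real (openConn x' y) ≤
      μ.real ((openConn x' y : Set (BondConfig (Site d))) \ openConnIn ((↑A : Set (Site d))ᶜ) x' y) +
        μ.real (openConnIn ((↑A : Set (Site d))ᶜ) x' y) :=
    calc μ.real (openConn x' y)
        ≤ μ.real (((openConn x' y : Set (BondConfig (Site d))) \ openConnIn ((↑A : Set (Site d))ᶜ) x' y) ∪
            openConnIn ((↑A : Set (Site d))ᶜ) x' y) := measureReal_mono (Set.subset_sdiff_union _ _) (measure_ne_top _ _)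
      _ ≤ _ := measureReal_union_le _ _
  have h2 : μ.real ((openConn x' y : Set (BondConfig (Site d))) \ openConnIn ((↑A : Set (Site d))ᶜ) x' y) ≤
      ∑ z ∈ A, μ.real (openConn x' z □ openConn z y) :=
    calc μ.real ((openConn x' y : Set (BondConfig (Site d))) \ openConnIn ((↑A : Set (Site d))ᶜ) x' y)
        ≤ μ.real (⋃ z ∈ A, (openConn x' z □ openConn z y : Set (BondConfig (Site d)))) :=
          measureReal_mono (by
            simpa only [Finset.mem_coe] using openConn_diff_openConnIn_compl_subset (↑A) x' y)
            (measure_ne_top _ _)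
      _ ≤ ∑ z ∈ A, μ.real (openConn x' z □ openConn z y) := measureReal_biUnion_finset_le _ _
  have h3 : ∀ z ∈ A, μ.real (openConn x' z □ openConn z y) ≤ tau d p x' z * tau d p z y := fun z _ => by
    rw [tau_def, tau_def]
    exact bk_finitary (zdGraph d) p (isUpperSet_openConn x' z) (isUpperSet_openConn z y)
      (isFinitary_openConn x' z) (isFinitary_openConn z y)
  rw [tau_def]
  linarith [Finset.sum_le_sum h3]

end Events

/-! ### (5.6)–(5.7): `Σ_{z ∈ A} |z - x'|^{2-d}` is small for sparse `A` far from `x'` -/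

section Sparse

/-- `(2^{t+2})⁴ log⁷(2^{t+2}) ≤ 2¹¹ ψ(2^{t+1})`. [cite: KozmaNachmias2011, proof of Lemma 5.3 ((5.7), p. 401)] -/
theorem pow_four_log_seven_le_psiKN (t : ℕ) :
    ((2 : ℝ) ^ (t + 2)) ^ 4 * Real.log ((2 : ℝ) ^ (t + 2)) ^ 7 ≤
      2 ^ 11 * psiKN d ((2 : ℝ) ^ (t + 1)) := by
  have hlog2 : 0 < Real.log 2 := Real.log_pos one_lt_two
  have hl1 : Real.log ((2 : ℝ) ^ (t + 1)) = (t + 1) * Real.log 2 := by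
    rw [Real.log_pow]; push_cast; ring
  have hl2 : Real.log ((2 : ℝ) ^ (t + 2)) = (t + 2) * Real.log 2 := by
    rw [Real.log_pow]; push_cast; ring
  have hlnn : 0 ≤ Real.log ((2 : ℝ) ^ (t + 1)) := by rw [hl1]; positivity
  have hle : Real.log ((2 : ℝ) ^ (t + 2)) ≤ 2 * Real.log ((2 : ℝ) ^ (t + 1)) := by
    rw [hl1, hl2]; nlinarith
  have h7 : Real.log ((2 : ℝ) ^ (t + 2)) ^ 7 ≤ (2 * Real.log ((2 : ℝ) ^ (t + 1))) ^ 7 :=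
    pow_le_pow_left₀ (by rw [hl2]; positivity) hle 7
  have hpow : ((2 : ℝ) ^ (t + 2)) ^ 4 = 16 * ((2 : ℝ) ^ (t + 1)) ^ 4 := by ring
  calc ((2 : ℝ) ^ (t + 2)) ^ 4 * Real.log ((2 : ℝ) ^ (t + 2)) ^ 7
      ≤ (16 * ((2 : ℝ) ^ (t + 1)) ^ 4) * (2 * Real.log ((2 : ℝ) ^ (t + 1))) ^ 7 := by
        rw [hpow]; exact mul_le_mul_of_nonneg_left h7 (by positivity)
    _ = 2 ^ 11 * (((2 : ℝ) ^ (t + 1)) ^ 4 * Real.log ((2 : ℝ) ^ (t + 1)) ^ 7) := by ring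
    _ ≤ 2 ^ 11 * psiKN d ((2 : ℝ) ^ (t + 1)) :=
        mul_le_mul_of_nonneg_left (pow_mul_log_le_psiKN (by positivity)) (by positivity)

/-- **(5.6)–(5.7) with the tail**: for every `δ > 0`, for `K` large, if `‖x' - x‖ ≤ 2K`, every point of
`A` is at sup-distance `≥ K` from `x'`, and `A` has fewer than `s⁴ log⁷ s` points in `x + Q_s` for every
`s ≥ K` (the bound (5.7) at a `K`-regular `x`), then `Σ_{z ∈ A} |z - x'|^{2-d} ≤ δ` — the dyadic
decomposition of `KozmaNachmiasTwoPointSums.sum_twoPtWt_le_sum_shell`, the shells of scale `2^t < K`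
being empty and those with `2^t ≥ K` containing fewer than `(2^{t+2})⁴ log⁷ 2^{t+2} ≤ 2¹¹ ψ(2^{t+1})`
points, and `tail_large`. [cite: KozmaNachmias2011, proof of Lemma 5.3 ((5.6)–(5.7), pp. 400–401)] -/
theorem sum_twoPtWt_le_of_sparse (hd : 7 ≤ d) {δ : ℝ} (hδ : 0 < δ) :
    ∃ K₀ : ℕ, ∀ K : ℕ, K₀ ≤ K → ∀ (x x' : Site d) (A : Finset (Site d)),
      ‖x' - x‖ ≤ 2 * K → (∀ z ∈ A, (K : ℝ) ≤ ‖z - x'‖) →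
      (∀ s : ℕ, K ≤ s → (#((box d s).filter fun w => x + w ∈ A) : ℝ) < (s : ℝ) ^ 4 * Real.log s ^ 7) →
      ∑ z ∈ A, twoPtWt d x' z ≤ δ := by
  classical
  have hd2 : 2 ≤ d := by omega
  obtain ⟨K₀, hK₀⟩ := tail_large hd (δ := δ / 2 ^ 11) (by positivity)
  refine ⟨K₀, fun K hK x x' A hxx' hfar hsparse => ?_⟩
  obtain ⟨T, hT⟩ := exists_dyadicScale_le x' A
  have h1 := sum_twoPtWt_le_sum_shell hd2 x' A hT
  -- the shells with `2^t < K` are empty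
  have hempty : ∀ t ∈ Finset.range (T + 1), 2 ^ t < K →
      #(A.filter fun z => Site.supNorm (z - x') ≤ 2 ^ t) = 0 := by
    intro t _ ht
    rw [Finset.card_eq_zero, Finset.filter_eq_empty_iff]
    intro z hz hle
    have h := hfar z hz
    rw [Site.norm_eq_supNorm] at h
    have : (K : ℝ) ≤ ((2 ^ t : ℕ) : ℝ) := h.trans (by exact_mod_cast hle)
    have : K ≤ 2 ^ t := by exact_mod_cast this
    omega
  -- the shells with `2^t ≥ K` are sparse
  have hcount : ∀ t ∈ Finset.range (T + 1), K ≤ 2 ^ t →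
      (#(A.filter fun z => Site.supNorm (z - x') ≤ 2 ^ t) : ℝ) ≤ 2 ^ 11 * psiKN d ((2 : ℝ) ^ (t + 1)) := by
    intro t _ ht
    have hinj : #(A.filter fun z => Site.supNorm (z - x') ≤ 2 ^ t) ≤
        #((box d (2 ^ (t + 2))).filter fun w => x + w ∈ A) := by
      refine Finset.card_le_card_of_injOn (fun z => z - x) (fun z hz => ?_) (fun z₁ _ z₂ _ h => by simpa using h)
      rw [Finset.mem_coe, Finset.mem_filter] at hz ⊢
      refine ⟨?_, by rw [add_sub_cancel]; exact hz.1⟩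
      rw [mem_box_iff_norm_le]
      have hzx' : ‖z - x'‖ ≤ (2 : ℝ) ^ t := by
        rw [Site.norm_eq_supNorm]; exact_mod_cast hz.2
      have hK2 : (2 : ℝ) * K ≤ 2 * 2 ^ t := by
        have : (K : ℝ) ≤ (2 : ℝ) ^ t := by exact_mod_cast ht
        linarith
      calc ‖z - x‖ = ‖(z - x') + (x' - x)‖ := by rw [sub_add_sub_cancel]
        _ ≤ ‖z - x'‖ + ‖x' - x‖ := norm_add_le _ _
        _ ≤ (2 : ℝ) ^ t + 2 * K := add_le_add hzx' hxx'
        _ ≤ ((2 ^ (t + 2) : ℕ) : ℝ) := by push_cast; rw [pow_add]; nlinarith [hK2]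
    have hs : K ≤ 2 ^ (t + 2) := le_trans ht (Nat.pow_le_pow_right (by norm_num) (by omega))
    have h2 := hsparse (2 ^ (t + 2)) hs
    push_cast at h2
    calc (#(A.filter fun z => Site.supNorm (z - x') ≤ 2 ^ t) : ℝ)
        ≤ #((box d (2 ^ (t + 2))).filter fun w => x + w ∈ A) := by exact_mod_cast hinj
      _ ≤ ((2 : ℝ) ^ (t + 2)) ^ 4 * Real.log ((2 : ℝ) ^ (t + 2)) ^ 7 := h2.le
      _ ≤ 2 ^ 11 * psiKN d ((2 : ℝ) ^ (t + 1)) := pow_four_log_seven_le_psiKN t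
  -- assemble
  set S₂ : Finset ℕ := (Finset.range (T + 1)).filter fun t => K ≤ 2 ^ t with hS₂
  have hS₂K : ∀ t ∈ S₂, (K : ℝ) ≤ (2 : ℝ) ^ t := fun t ht => by
    have := (Finset.mem_filter.1 ht).2; exact_mod_cast this
  have htail := hK₀ K hK S₂ hS₂K
  calc ∑ z ∈ A, twoPtWt d x' z
      ≤ ∑ t ∈ Finset.range (T + 1), shellWt d t * #(A.filter fun z => Site.supNorm (z - x') ≤ 2 ^ t) := h1
    _ = ∑ t ∈ S₂, shellWt d t * #(A.filter fun z => Site.supNorm (z - x') ≤ 2 ^ t) := by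
        rw [hS₂, Finset.sum_filter]
        refine Finset.sum_congr rfl fun t ht => ?_
        by_cases h : K ≤ 2 ^ t
        · rw [if_pos h]
        · rw [if_neg h, hempty t ht (not_le.1 h)]; simp
    _ ≤ ∑ t ∈ S₂, shellWt d t * (2 ^ 11 * psiKN d ((2 : ℝ) ^ (t + 1))) :=
        Finset.sum_le_sum fun t ht => mul_le_mul_of_nonneg_left
          (hcount t (Finset.mem_filter.1 ht).1 (Finset.mem_filter.1 ht).2) (shellWt_nonneg d t)
    _ = 2 ^ 11 * ∑ t ∈ S₂, shellWt d t * psiKN d ((2 : ℝ) ^ (t + 1)) := by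
        rw [Finset.mul_sum]; refine Finset.sum_congr rfl fun t _ => by ring
    _ ≤ 2 ^ 11 * (δ / 2 ^ 11) := mul_le_mul_of_nonneg_left htail (by positivity)
    _ = δ := by field_simp

end Sparse

/-! ### Lemma 5.3 -/

section Lemma53

/-- The pieces `E₁ ∩ {C(x;Q_j) = A} ∩ E₂` are measurable. [cite: KozmaNachmias2011, proof of Lemma 5.3 ((5.3), p. 400)] -/
theorem measurableSet_eventE1_inter_clusterInIs_inter_eventE2 (p : unitInterval) (j K M : ℕ)
    (x x' y : Site d) (A : Finset (Site d)) :
    MeasurableSet (eventE1 p j K M x ∩ clusterInIs (box d j) x A ∩ eventE2 j x x' y) := by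
  rw [Set.inter_assoc, Set.inter_comm (clusterInIs (box d j) x A), eventE2_inter_clusterInIs,
    ← Set.inter_assoc]
  exact ((measurableSet_eventE1 p j K M x).inter (measurableSet_openConnIn_compl A x' y)).inter
    (measurableSet_clusterInIs (box d j) x A)

/-- `P(E₁ ∩ E₂) ≥ Σ_{A ⊆ Q_j} P(E₁ ∩ {C(x;Q_j) = A} ∩ E₂)` (in fact an equality; the pieces are disjoint).
[cite: KozmaNachmias2011, proof of Lemma 5.3 ((5.3), p. 400)] -/
theorem sum_real_inter_clusterInIs_inter_eventE2_le (p : unitInterval) (j K M : ℕ) (x x' y : Site d) :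
    ∑ A ∈ (box d j).powerset,
        (bondPercolation (zdGraph d) p).real (eventE1 p j K M x ∩ clusterInIs (box d j) x A ∩ eventE2 j x x' y) ≤
      (bondPercolation (zdGraph d) p).real (eventE1 p j K M x ∩ eventE2 j x x' y) := by
  classical
  have hdisj : (↑(box d j).powerset : Set (Finset (Site d))).PairwiseDisjoint
      fun A => eventE1 p j K M x ∩ clusterInIs (box d j) x A ∩ eventE2 j x x' y := by
    intro A₁ _ A₂ _ hne
    rw [Function.onFun, Set.disjoint_left]
    rintro ω ⟨⟨-, h₁⟩, -⟩ ⟨⟨-, h₂⟩, -⟩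
    exact hne ((mem_clusterInIs.1 h₁).symm.trans (mem_clusterInIs.1 h₂))
  rw [← measureReal_biUnion_finset hdisj
    fun A _ => measurableSet_eventE1_inter_clusterInIs_inter_eventE2 p j K M x x' y A]
  refine measureReal_mono (Set.iUnion₂_subset fun A _ => ?_) (measure_ne_top _ _)
  rintro ω ⟨⟨h1, -⟩, h2⟩
  exact ⟨h1, h2⟩

/-- **Kozma–Nachmias 2011, Lemma 5.3, PROVED** (p. 400) at `p = p_c` on `ℤ^d`, `d > 6`, under the
two-point estimate `TwoPointBoundedRatio d`: there are `c > 0` and `K₀` such that for `K ≥ K₀`, every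
`x ∈ ∂Q_j`, every auxiliary vertex `x'` with `‖x' - x‖ ≤ 2K` at sup-distance `≥ K` from `Q_j`, every
`M` and every `L ≥ 2K`,
`Σ_{y ∈ (x + Q_L) ∖ Q_j} P(E₁(x, M, K) ∩ E₂(x, x', y)) ≥ c L² P(E₁(x, M, K))`.
[cite: KozmaNachmias2011, Lemma 5.3 (p. 400) and its proof (pp. 400–401)] -/
theorem KozmaNachmias2011_lemma53 (hd : 6 < d) (hτ : TwoPointBoundedRatio d) :
    ∃ c : ℝ, 0 < c ∧ ∃ K₀ : ℕ, ∀ K : ℕ, K₀ ≤ K → ∀ (j M L : ℕ) (x x' : Site d),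
      x ∈ sphere d j → ‖x' - x‖ ≤ 2 * K → (∀ z ∈ box d j, (K : ℝ) ≤ ‖z - x'‖) → 2 * K ≤ L →
      c * (L : ℝ) ^ 2 *
          (bondPercolation (zdGraph d) (criticalProbI d)).real (eventE1 (criticalProbI d) j K M x) ≤
        ∑ w ∈ (box d L).filter (fun w => x + w ∉ box d j),
          (bondPercolation (zdGraph d) (criticalProbI d)).real
            (eventE1 (criticalProbI d) j K M x ∩ eventE2 j x x' (x + w)) := by
  classical
  have hd2 : 2 ≤ d := by omega
  have hd7 : 7 ≤ d := hd
  set p := criticalProbI d with hp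
  obtain ⟨C', C, hC', hC'C, hb⟩ := hτ.natPow hd2
  have hC : 0 ≤ C := hC'.le.trans hC'C
  obtain ⟨C₀, hC₀, hbox⟩ := exists_sum_tau_box_le p hd2 hC fun x y hxy => (hb x y hxy).2
  have hc' : 0 < C' / 4 ^ (d - 1) := by positivity
  obtain ⟨K₁, hK₁⟩ := sum_twoPtWt_le_of_sparse (d := d) hd7
    (δ := C' / 4 ^ (d - 1) / (2 * C₀ * max C 1)) (by positivity)
  refine ⟨C' / 4 ^ (d - 1) / 2, by positivity, max K₁ 1, fun K hK j M L x x' hx hxx' hfar hKL => ?_⟩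
  have hK1 : 1 ≤ K := le_trans (le_max_right _ _) hK
  have hL2 : 2 ≤ L := by omega
  have hL1 : 1 ≤ L := by omega
  have hxx'L : ‖x' - x‖ ≤ L := hxx'.trans (by exact_mod_cast hKL)
  set μ := bondPercolation (zdGraph d) p with hμ
  set W : Finset (Site d) := (box d L).filter (fun w => x + w ∉ box d j) with hW
  -- the lower bound `Σ_w P(x' ↔ x + w in Aᶜ) ≥ (c'/2) L²` for a sparse `A ⊆ Q_j`
  have hoff : ∀ A : Finset (Site d), A ⊆ box d j →
      (∀ s : ℕ, K ≤ s → (#((box d s).filter fun w => x + w ∈ A) : ℝ) < (s : ℝ) ^ 4 * Real.log s ^ 7) →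
      C' / 4 ^ (d - 1) / 2 * (L : ℝ) ^ 2 ≤
        ∑ w ∈ W, μ.real (openConnIn ((↑A : Set (Site d))ᶜ) x' (x + w)) := by
    intro A hAbox hsparse
    have hfarA : ∀ z ∈ A, (K : ℝ) ≤ ‖z - x'‖ := fun z hz => hfar z (hAbox hz)
    have hsp : ∑ z ∈ A, twoPtWt d x' z ≤ C' / 4 ^ (d - 1) / (2 * C₀ * max C 1) :=
      hK₁ K (le_trans (le_max_left _ _) hK) x x' A hxx' hfarA hsparse
    -- main term
    have hmain : C' / 4 ^ (d - 1) * (L : ℝ) ^ 2 ≤ ∑ w ∈ W, tau d p x' (x + w) :=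
      sum_tau_lower p hd2 hC' (fun a b hab => (hb a b hab).1) hx hxx'L hL2
    -- error term
    have herr : ∑ w ∈ W, ∑ z ∈ A, tau d p x' z * tau d p z (x + w) ≤
        C' / 4 ^ (d - 1) / 2 * (L : ℝ) ^ 2 := by
      rw [Finset.sum_comm]
      have h1 : ∀ z ∈ A, ∑ w ∈ W, tau d p x' z * tau d p z (x + w) ≤ tau d p x' z * (C₀ * (L : ℝ) ^ 2) := by
        intro z _
        rw [← Finset.mul_sum]
        refine mul_le_mul_of_nonneg_left ?_ (tau_nonneg p x' z)
        calc ∑ w ∈ W, tau d p z (x + w) ≤ ∑ w ∈ box d L, tau d p z (x + w) :=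
              Finset.sum_le_sum_of_subset_of_nonneg (Finset.filter_subset _ _) fun w _ _ => tau_nonneg p z _
          _ ≤ C₀ * (L : ℝ) ^ 2 := hbox z x L hL1
      have h2 : ∑ z ∈ A, tau d p x' z ≤ max C 1 * ∑ z ∈ A, twoPtWt d x' z := by
        rw [Finset.mul_sum]
        exact Finset.sum_le_sum fun z _ => tau_le_mul_twoPtWt p (fun a b hab => (hb a b hab).2) x' z
      calc ∑ z ∈ A, ∑ w ∈ W, tau d p x' z * tau d p z (x + w)
          ≤ ∑ z ∈ A, tau d p x' z * (C₀ * (L : ℝ) ^ 2) := Finset.sum_le_sum h1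
        _ = (∑ z ∈ A, tau d p x' z) * (C₀ * (L : ℝ) ^ 2) := by rw [Finset.sum_mul]
        _ ≤ (max C 1 * (C' / 4 ^ (d - 1) / (2 * C₀ * max C 1))) * (C₀ * (L : ℝ) ^ 2) :=
            mul_le_mul_of_nonneg_right (h2.trans (mul_le_mul_of_nonneg_left hsp (by positivity)))
              (by positivity)
        _ = C' / 4 ^ (d - 1) / 2 * (L : ℝ) ^ 2 := by
            have hmax : 0 < max C 1 := by positivity
            field_simp
    calc C' / 4 ^ (d - 1) / 2 * (L : ℝ) ^ 2
        = C' / 4 ^ (d - 1) * (L : ℝ) ^ 2 - C' / 4 ^ (d - 1) / 2 * (L : ℝ) ^ 2 := by ring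
      _ ≤ ∑ w ∈ W, tau d p x' (x + w) - ∑ w ∈ W, ∑ z ∈ A, tau d p x' z * tau d p z (x + w) :=
          sub_le_sub hmain herr
      _ = ∑ w ∈ W, (tau d p x' (x + w) - ∑ z ∈ A, tau d p x' z * tau d p z (x + w)) := by
          rw [Finset.sum_sub_distrib]
      _ ≤ ∑ w ∈ W, μ.real (openConnIn ((↑A : Set (Site d))ᶜ) x' (x + w)) :=
          Finset.sum_le_sum fun w _ => tau_sub_sum_le_real_openConnIn_compl p A x' (x + w)
  -- the bound for one value `A` of the cluster
  have key : ∀ A ∈ (box d j).powerset,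
      C' / 4 ^ (d - 1) / 2 * (L : ℝ) ^ 2 * μ.real (eventE1 p j K M x ∩ clusterInIs (box d j) x A) ≤
        ∑ w ∈ W, μ.real (eventE1 p j K M x ∩ clusterInIs (box d j) x A ∩ eventE2 j x x' (x + w)) := by
    intro A hA
    have hAbox : A ⊆ box d j := Finset.mem_powerset.1 hA
    rw [Finset.sum_congr rfl fun w _ => real_eventE1_inter_clusterInIs_inter_eventE2 p j K M x x' (x + w) A,
      ← Finset.mul_sum, mul_comm]
    rcases Set.eq_empty_or_nonempty (eventE1 p j K M x ∩ clusterInIs (box d j) x A) with h0 | ⟨ω₀, hω₀⟩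
    · rw [h0, measureReal_empty, zero_mul, zero_mul]
    · refine mul_le_mul_of_nonneg_left (hoff A hAbox fun s hs => ?_) measureReal_nonneg
      have h := card_filter_add_mem_clusterIn_lt_of_mem_eventE1 hω₀.1 hs
      rwa [mem_clusterInIs.1 hω₀.2] at h
  -- sum over `A`
  calc C' / 4 ^ (d - 1) / 2 * (L : ℝ) ^ 2 * μ.real (eventE1 p j K M x)
      = ∑ A ∈ (box d j).powerset,
          C' / 4 ^ (d - 1) / 2 * (L : ℝ) ^ 2 * μ.real (eventE1 p j K M x ∩ clusterInIs (box d j) x A) := by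
        rw [measureReal_eq_sum_inter_clusterInIs p (box d j) x (measurableSet_eventE1 p j K M x), Finset.mul_sum]
    _ ≤ ∑ A ∈ (box d j).powerset, ∑ w ∈ W,
          μ.real (eventE1 p j K M x ∩ clusterInIs (box d j) x A ∩ eventE2 j x x' (x + w)) :=
        Finset.sum_le_sum key
    _ = ∑ w ∈ W, ∑ A ∈ (box d j).powerset,
          μ.real (eventE1 p j K M x ∩ clusterInIs (box d j) x A ∩ eventE2 j x x' (x + w)) := Finset.sum_comm
    _ ≤ ∑ w ∈ W, μ.real (eventE1 p j K M x ∩ eventE2 j x x' (x + w)) :=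
        Finset.sum_le_sum fun w _ => sum_real_inter_clusterInIs_inter_eventE2_le p j K M x x' (x + w)

end Lemma53


end Literature.Barriers.CriticalPhenomena

end
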